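import Summits.ABC.IUTFork.Thm311RealInd1StripTwistJW
import HarnessLib

/-!
# [IUTchIII] Thm 3.11 (i) (Ind1) at `v ∈ 𝕍^non`, EVEN local degree: Kondo's plane transvections AND the FIRST-PLANE transvection
# `y_2 ↦ y_2 + y_1` (Jannsen–Wingberg's `ψ` at `n = 2`, Hoshi–Nishio's `*α` at `d(G) = 2`, Kondo's `φ` of Lemma 2.5) PROVED at
# every `K_v` from the group-level fact `JannsenWingbergTwistsFirst`

PROOF-ONLY file (abc-iut cell, Cor. 3.12 sub-crew, seat abc-iut-c312-1 = holder of record of the typed [IUTchIII] Thm. 3.11,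
gen 12; row «R14 FIRST-PLANE TWIST», part b).  TAKES NO SIDE on [IUTchIII] Cor. 3.12.

* **`Real.dehnTwistsFirst_closureAt_of_jannsenWingbergFirst`** — assuming the GROUP-LEVEL fact `JannsenWingbergTwistsFirst`
  (v3 of `Literature/AnabelianGeometry/AbsoluteAnabelian/MLFGaloisJannsenWingbergTwists.lean`: for EVEN `d = [k : ℚ_p] ≥ 2`,
  `p` odd, the Jannsen–Wingberg generators `σ, τ, x_0, …, x_d` of `G_k` read through THE reciprocity map, topological generation
  of the principal units, the abelianised relation, the twist pairs `x_b ↦ x_b x_a`, `x_a ↦ x_a x_b⁻¹` on Kondo's planes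
  `(x_{2i+1}, x_{2i+2})`, `i ≥ 1`, AND the twist `x_2 ↦ x_2 x_1` fixing `σ, τ, x_j` (`j ≠ 2`) — Jannsen–Wingberg 1982 §5.1 with
  `n = 2`, Hoshi–Nishio 2022 p. 5 l. 22–24 / Thm. 1.5 at `d(G) = 2`, Kondo 2025 Lemma 2.5 and the proof of Thm. 2.3), at every
  finite place `v ∣ p` of a number field with `p` odd and `d = [K_v : ℚ_p] ≥ 2` EVEN: a `ℚ_p`-basis `y` of `K_v` indexed by
  `Fin 2 ⊕ Fin g × Fin 2` (`y_{inl 0} = y_1`, `y_{inl 1} = y_2`, the planes `y_{inr (i, ·)}`) such that every plane carries both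
  elementary transvections AND the first pair carries the transvection `t ↦ t + y^*_{inl 1}(t)·y_{inl 0}` (`y_2 ↦ y_2 + y_1`,
  every other basis vector fixed — Kondo p. 10: «`φ_+(α_1y_1 + α_2y_2) = (α_1 + α_2)y_1 + α_2y_2`»), each realised by a
  topological automorphism of `G_v` through THE equivariant lift on unit logarithms (`MLFClosure.LiftActsOnUnitLogAs`).  The
  proof is the gen-11 proof of `Real.dehnTwists_closureAt_of_jannsenWingberg` (Hoshi–Nishio Lemma 1.3 PROVED: the logarithms of
  topological generators span, `y_0 ∈ ℚ_p y_1` by the abelianised relation; Kondo's computation PROVED: `θ(liftUnits φ u) =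
  φ^{ab}(θ u)` turns `φ(x_2) = x_2 x_1` into `liftUnits φ (u_2) = u_2 u_1`, whence `log ∘ liftUnits φ` is the transvection on
  generators, whence everywhere) run with `c = 2` and one more twist.  The case `d = 2` (`g = 0`, no planes) is the QUADRATIC
  `K_v` — the first local degree at which print's (Ind1) strip part is non-trivial (Hoshi–Nishio Rmk. 1.7: trivial at `d = 1`).
HONEST SCOPE: a conditional theorem (binder `hJW`) about OUR typed objects at ONE place; the sequel derives the statements of
record (quadratic `K_v`; Kondo's Thm. 2.3 for even `d`); nothing here asserts or refutes [IUTchIII] Cor. 3.12; nothing is claimed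
about abc.  [claim: Mochizuki2012, status: disputed]; [cite: HoshiNishio2022OuterAutMLF, Lemma 1.3 and §1 p.5 l.22–31];
[cite: Kondo2025OuterAutMLF, §2 Lemma 2.5 and proof of Thm 2.3 p.10]; [cite: JannsenWingberg1982, Thm 2 p.75 and §5.1 p.96];
[cite: NeukirchSchmidtWingberg2008, Thm 7.5.14].  typed ≠ proved; a conditional theorem discharges nothing it binds.
-/

set_option autoImplicit false

noncomputable section

open Metric Set
open scoped Pointwise

namespace Summit.ABC.IUTFork.Thm311.Real

open NumberField IsDedekindDomain Literature.NumberTheory.NumberFields Literature.IUT.LogVolume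
open Literature.NumberTheory.GaloisRepresentations
open Literature.AnabelianGeometry.AbsoluteAnabelian Literature.IUT.HodgeArakelov
open Literature.IUT.HodgeArakelov.AbsTopMonoids

variable {F : Type} [Field F] [NumberField F] (v : HeightOneSpectrum (𝓞 F))

/-- A twist pair on `(x_a, x_b)` contains the single twist `x_b ↦ x_b x_a`. [cite: Kondo2025OuterAutMLF, §2 proof of Thm 2.3 p.10] -/
theorem jwTwist_of_jwTwistPair {G : Type*} [Group G] [TopologicalSpace G]
    {σ τ : G} {x : ℕ → G} {d a b : ℕ} (h : JWTwistPair σ τ x d a b) : JWTwist σ τ x d a b :=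
  h.1

/-- **Kondo's plane transvections AND the first-plane transvection `y_2 ↦ y_2 + y_1` AT `closureAt v`, FROM THE GROUP-LEVEL FACT
`JannsenWingbergTwistsFirst`.**  At a finite place `v` of a number field `F` with ODD residue characteristic `p_v` and EVEN
`d = [K_v : ℚ_{p_v}] ≥ 2`, there are `g` (`2 + 2g = d`) and a `ℚ_{p_v}`-basis `y` of `K_v` indexed by `Fin 2 ⊕ Fin g × Fin 2` such
that (planes) every plane `i` carries BOTH elementary transvections `φ_i : y_{(i,1)} ↦ y_{(i,1)} + y_{(i,0)}`,
`φ'_i : y_{(i,0)} ↦ y_{(i,0)} − y_{(i,1)}`, and (first pair) `φ : y_{inl 1} ↦ y_{inl 1} + y_{inl 0}` — every other basis vector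
fixed in each case — realised by topological automorphisms of `G_v` through THE equivariant lift on unit logarithms
(`MLFClosure.LiftActsOnUnitLogAs`).  `y_{inl 0} = log θ⁻¹[x_1]`, `y_{inl 1} = log θ⁻¹[x_2]`, `y_{inr (i, ε)} = log θ⁻¹[x_{2i+3+ε}]`
(Hoshi–Nishio Lemma 1.3, PROVED here as in gen 11).  For `d = 2` (`g = 0`) only the first-pair clause has content: the QUADRATIC
`K_v`. [claim: Mochizuki2012, status: disputed] [cite: HoshiNishio2022OuterAutMLF, Lemma 1.3 and §1 p.5 l.22–31]
[cite: Kondo2025OuterAutMLF, §2 Lemma 2.5 and proof of Thm 2.3 p.10] [cite: JannsenWingberg1982, §5.1 p.96] -/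
theorem dehnTwistsFirst_closureAt_of_jannsenWingbergFirst (hJW : JannsenWingbergTwistsFirst)
    [Fact (closureAt v).residueChar.Prime]
    (hpk : ValuativeRel.valuation (v.adicCompletion F) (closureAt v).residueChar < 1) (hp2 : (closureAt v).residueChar ≠ 2)
    (hfin : haveI : CharZero (closureAt v).k := (closureAt v).instChar
      letI : Algebra ℚ_[(closureAt v).residueChar] (closureAt v).k :=
        LocalField.padicAlgebra (closureAt v).k (closureAt v).residueChar hpk
      2 ≤ Module.finrank ℚ_[(closureAt v).residueChar] (closureAt v).k)
    (hev : haveI : CharZero (closureAt v).k := (closureAt v).instChar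
      letI : Algebra ℚ_[(closureAt v).residueChar] (closureAt v).k :=
        LocalField.padicAlgebra (closureAt v).k (closureAt v).residueChar hpk
      Even (Module.finrank ℚ_[(closureAt v).residueChar] (closureAt v).k)) :
    haveI : CharZero (closureAt v).k := (closureAt v).instChar
    letI : Algebra ℚ_[(closureAt v).residueChar] (closureAt v).k :=
      LocalField.padicAlgebra (closureAt v).k (closureAt v).residueChar hpk
    ∃ (g : ℕ) (_ : 2 + 2 * g = Module.finrank ℚ_[(closureAt v).residueChar] (closureAt v).k)
      (y : Module.Basis (Fin 2 ⊕ Fin g × Fin 2) ℚ_[(closureAt v).residueChar] (closureAt v).k),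
      (∀ i : Fin g,
        (∃ φ : (ModelMLFGaloisData.galois (closureAt v).k (closureAt v).K).tmPair.Pi ≃ₜ*
            (ModelMLFGaloisData.galois (closureAt v).k (closureAt v).K).tmPair.Pi,
          (closureAt v).LiftActsOnUnitLogAs (closureAt v).residueChar hpk φ fun t =>
            t + y.coord (Sum.inr (i, 1)) t • y (Sum.inr (i, 0))) ∧
        (∃ φ' : (ModelMLFGaloisData.galois (closureAt v).k (closureAt v).K).tmPair.Pi ≃ₜ*
            (ModelMLFGaloisData.galois (closureAt v).k (closureAt v).K).tmPair.Pi,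
          (closureAt v).LiftActsOnUnitLogAs (closureAt v).residueChar hpk φ' fun t =>
            t - y.coord (Sum.inr (i, 0)) t • y (Sum.inr (i, 1)))) ∧
      (∃ φ : (ModelMLFGaloisData.galois (closureAt v).k (closureAt v).K).tmPair.Pi ≃ₜ*
          (ModelMLFGaloisData.galois (closureAt v).k (closureAt v).K).tmPair.Pi,
        (closureAt v).LiftActsOnUnitLogAs (closureAt v).residueChar hpk φ fun t =>
          t + y.coord (Sum.inl 1) t • y (Sum.inl 0)) := by
  -- notation and structures
  have hv : (((closureAt v).residueChar : ℕ) : 𝓞 F) ∈ v.asIdeal := natCast_residueChar_closureAt_mem v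
  haveI : CharZero (v.adicCompletion F) := charZero_adicCompletion v
  letI iQ : Algebra ℚ_[(closureAt v).residueChar] (v.adicCompletion F) :=
    LocalField.padicAlgebra (v.adicCompletion F) (closureAt v).residueChar hpk
  haveI : ValuativeExtension (v.adicCompletion F) (v.adicCompletion F) := ⟨fun _ _ => Iff.rfl⟩
  haveI : ContinuousSMul ℚ_[(closureAt v).residueChar] (v.adicCompletion F) :=
    continuousSMul_of_algebraMap ℚ_[(closureAt v).residueChar] _
      (by exact LocalField.continuous_algebraMap_adicCompletionPadicAlgebra v (closureAt v).residueChar hv)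
  haveI : FiniteDimensional ℚ_[(closureAt v).residueChar] (RescaledCompletion F (closureAt v).residueChar v hv) :=
    FiniteDimensional.of_locallyCompactSpace ℚ_[(closureAt v).residueChar]
  set d := Module.finrank ℚ_[(closureAt v).residueChar] (v.adicCompletion F) with hd
  have hd2 : 2 ≤ d := hfin
  -- the Jannsen–Wingberg data at `K_v`, with the first-plane twist
  obtain ⟨σ, τ, x, u, s, H, -, -, hwild, hdense, hs, hH, htor, hplanes, hfirst⟩ :=
    hJW (v.adicCompletion F) (closureAt v).residueChar hpk hp2 (by omega) hev
  -- the principal units `u_j` as units of `𝒪_v`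
  have hunit : ∀ j, j ≤ d → ∃ w : (↥(v.adicCompletionIntegers F))ˣ, unitsToK v w = u j := by
    intro j hj
    apply exists_unit_coe_eq
    rw [Valuation.mem_unitGroup_iff]
    have h := Valuation.map_one_add_of_lt (ValuativeRel.valuation (v.adicCompletion F)) (hwild j hj).1
    rwa [add_sub_cancel] at h
  choose! uO huO using hunit
  set S : Set (↥(v.adicCompletionIntegers F))ˣ := uO '' Set.Iic d with hSdef
  have hSmap : (Subgroup.closure S).map (unitsToK v) = Subgroup.closure (u '' Set.Iic d) := by
    rw [MonoidHom.map_closure]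
    congr 1
    ext z
    constructor
    · rintro ⟨w, ⟨j, hj, rfl⟩, rfl⟩; exact ⟨j, hj, (huO j hj).symm⟩
    · rintro ⟨j, hj, rfl⟩; exact ⟨uO j, ⟨j, hj, rfl⟩, huO j hj⟩
  have hS : ∀ w : (↥(v.adicCompletionIntegers F))ˣ,
      ValuativeRel.valuation (v.adicCompletion F) (((w : ↥(v.adicCompletionIntegers F)) : v.adicCompletion F) - 1) < 1 →
        unitsToK v w ∈ (((Subgroup.closure S).map (unitsToK v)).topologicalClosure : Subgroup (v.adicCompletion F)ˣ) := by
    intro w hw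
    rw [hSmap]
    exact hdense (unitsToK v w) hw
  -- the logarithms `y_j`, read in the rescaled completion
  set e := RescaledCompletion.of F (closureAt v).residueChar v hv with he
  let eL : v.adicCompletion F ≃ₗ[ℚ_[(closureAt v).residueChar]] RescaledCompletion F (closureAt v).residueChar v hv :=
    { e.toAddEquiv with
      map_smul' := fun c x => by
        change e (c • x) = c • e x
        rw [Algebra.smul_def, Algebra.smul_def, map_mul]
        rfl }
  have heL : ∀ z, eL z = e z := fun z => rfl
  let yR : ℕ → RescaledCompletion F (closureAt v).residueChar v hv := fun j => e (galoisLog v (Additive.ofMul (uO j)))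
  -- (Hoshi–Nishio Lemma 1.3, spanning) every element is in the span of `y_0, …, y_d`
  have hspan : ∀ z, z ∈ Submodule.span ℚ_[(closureAt v).residueChar] (yR '' Set.Iic d) := by
    intro z
    have h := mem_span_of_galoisLog_of_generators v (closureAt v).residueChar hv S hS z
    rwa [hSdef, Set.image_image] at h
  -- the abelianised relation: `H • y_0 + p^s • y_1 = 0`
  have htor' : IsOfFinOrder (uO 0 ^ H * uO 1 ^ ((closureAt v).residueChar ^ s)) := by
    have hmap : unitsToK v (uO 0 ^ H * uO 1 ^ ((closureAt v).residueChar ^ s)) =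
        u 0 ^ H * u 1 ^ ((closureAt v).residueChar ^ s) := by
      rw [map_mul, map_zpow, map_pow, huO 0 (by omega), huO 1 (by omega)]
    obtain ⟨n, hn, hpow⟩ := htor.exists_pow_eq_one
    exact isOfFinOrder_iff_pow_eq_one.mpr ⟨n, hn, unitsToK_injective v (by rw [map_pow, hmap, hpow, map_one])⟩
  have hrel : (H : ℚ_[(closureAt v).residueChar]) • yR 0 +
      (((closureAt v).residueChar ^ s : ℕ) : ℚ_[(closureAt v).residueChar]) • yR 1 = 0 := by
    obtain ⟨n, hn, hpow⟩ := htor'.exists_pow_eq_one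
    have h0 : galoisLog v (Additive.ofMul (uO 0 ^ H * uO 1 ^ ((closureAt v).residueChar ^ s))) = 0 := by
      have h1 : (n : v.adicCompletion F) *
          galoisLog v (Additive.ofMul (uO 0 ^ H * uO 1 ^ ((closureAt v).residueChar ^ s))) = 0 := by
        rw [← nsmul_eq_mul, ← map_nsmul, ← ofMul_pow, hpow, ofMul_one, map_zero]
      exact (mul_eq_zero.mp h1).resolve_left (by exact_mod_cast hn.ne')
    rw [ofMul_mul, ofMul_zpow, ofMul_pow, map_add, map_zsmul, map_nsmul] at h0
    have h1 := congrArg e h0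
    rw [map_add, map_zsmul, map_nsmul, map_zero, ← Int.cast_smul_eq_zsmul ℚ_[(closureAt v).residueChar],
      ← Nat.cast_smul_eq_nsmul ℚ_[(closureAt v).residueChar]] at h1
    exact h1
  have hy0 : yR 0 ∈ Submodule.span ℚ_[(closureAt v).residueChar] {yR 1} := by
    have hH0 : (H : ℚ_[(closureAt v).residueChar]) ≠ 0 := by exact_mod_cast hH
    have h1 : (H : ℚ_[(closureAt v).residueChar]) • yR 0 =
        -((((closureAt v).residueChar ^ s : ℕ) : ℚ_[(closureAt v).residueChar]) • yR 1) :=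
      eq_neg_of_add_eq_zero_left hrel
    have h : yR 0 = (H : ℚ_[(closureAt v).residueChar])⁻¹ •
        (-((((closureAt v).residueChar ^ s : ℕ) : ℚ_[(closureAt v).residueChar]) • yR 1)) := by
      rw [← h1, smul_smul, inv_mul_cancel₀ hH0, one_smul]
    rw [h, ← smul_neg, smul_smul]
    exact Submodule.smul_mem _ _ (Submodule.neg_mem _ (Submodule.mem_span_singleton_self _))
  -- hence `y_1, …, y_d` span
  have hspan1 : ∀ z, z ∈ Submodule.span ℚ_[(closureAt v).residueChar] (yR '' Set.Icc 1 d) := by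
    intro z
    have hsub : yR '' Set.Iic d ⊆ (Submodule.span ℚ_[(closureAt v).residueChar] (yR '' Set.Icc 1 d) :
        Set (RescaledCompletion F (closureAt v).residueChar v hv)) := by
      rintro _ ⟨j, hj, rfl⟩
      rcases Nat.eq_zero_or_pos j with rfl | hjpos
      · refine Submodule.span_mono ?_ hy0
        rintro _ rfl
        exact ⟨1, ⟨le_rfl, by omega⟩, rfl⟩
      · exact Submodule.subset_span ⟨j, ⟨hjpos, hj⟩, rfl⟩
    exact Submodule.span_le.mpr hsub (hspan z)
  -- Kondo's indexing for even `d`: `c = 2`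
  let g : ℕ := (d - 2) / 2
  have hcg : 2 + 2 * g = d := by
    obtain ⟨m, hm⟩ := hev
    simp only [g]
    omega
  let idx : Fin 2 ⊕ Fin g × Fin 2 → ℕ := fun s' =>
    Sum.elim (fun t : Fin 2 => (t : ℕ) + 1) (fun iε : Fin g × Fin 2 => 2 + 2 * (iε.1 : ℕ) + 1 + (iε.2 : ℕ)) s'
  have hidx_inj : Function.Injective idx := jwIndex_injective 2 g
  have hidx_mem : ∀ s', 1 ≤ idx s' ∧ idx s' ≤ d := by
    rintro (t | ⟨i, ε⟩)
    · have := t.2; simp only [idx, Sum.elim_inl]; omega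
    · have := i.2; have := ε.2; simp only [idx, Sum.elim_inr]; omega
  -- the basis of `K_v^{(1/n_v)}`, then of `K_v`
  let bfam : Fin 2 ⊕ Fin g × Fin 2 → RescaledCompletion F (closureAt v).residueChar v hv := fun s' => yR (idx s')
  have hle : ⊤ ≤ Submodule.span ℚ_[(closureAt v).residueChar] (Set.range bfam) := by
    intro z _
    have hsub : yR '' Set.Icc 1 d ⊆ Set.range bfam := by
      rintro _ ⟨j, ⟨hj1, hj2⟩, rfl⟩
      obtain ⟨s', hs'⟩ := exists_jwIndex_eq 2 g hj1 (by omega)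
      exact ⟨s', by simp only [bfam, idx]; rw [hs']⟩
    exact Submodule.span_mono hsub (hspan1 z)
  have hcard : Fintype.card (Fin 2 ⊕ Fin g × Fin 2) =
      Module.finrank ℚ_[(closureAt v).residueChar] (RescaledCompletion F (closureAt v).residueChar v hv) := by
    rw [← eL.finrank_eq]
    simp only [Fintype.card_sum, Fintype.card_prod, Fintype.card_fin]
    omega
  let bR : Module.Basis (Fin 2 ⊕ Fin g × Fin 2) ℚ_[(closureAt v).residueChar]
      (RescaledCompletion F (closureAt v).residueChar v hv) := basisOfTopLeSpanOfCardEqFinrank bfam hle hcard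
  have hbR : ∀ s', bR s' = yR (idx s') := fun s' => by
    change (basisOfTopLeSpanOfCardEqFinrank bfam hle hcard : _ → _) s' = _
    rw [coe_basisOfTopLeSpanOfCardEqFinrank]
  let y : Module.Basis (Fin 2 ⊕ Fin g × Fin 2) ℚ_[(closureAt v).residueChar] (v.adicCompletion F) := bR.map eL.symm
  have hy : ∀ s', y s' = galoisLog v (Additive.ofMul (uO (idx s'))) := fun s' => by
    change eL.symm (bR s') = _
    rw [hbR]
    exact e.symm_apply_apply _
  have hycoord : ∀ s' t, y.coord s' t = bR.coord s' (e t) := by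
    intro s' t
    change (bR.map eL.symm).repr t s' = bR.repr (eL t) s'
    rw [Module.Basis.map_repr, LinearEquiv.trans_apply, LinearEquiv.symm_symm]
  -- coordinates of the `y_j`, `j ≤ d`, at any index other than that of `y_1`
  have hcoord : ∀ (s₀ : Fin 2 ⊕ Fin g × Fin 2) (j : ℕ), j ≤ d → idx s₀ ≠ 1 →
      bR.coord s₀ (yR j) = if j = idx s₀ then 1 else 0 := by
    intro s₀ j hj hs₀
    rcases Nat.eq_zero_or_pos j with rfl | hjpos
    · -- `y_0 = λ • y_1 = λ • bR (inl 0)`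
      obtain ⟨s₁, hs₁⟩ := exists_jwIndex_eq 2 g (le_refl 1) (by omega : 1 ≤ 2 + 2 * g)
      have hs₁' : idx s₁ = 1 := hs₁
      have hne01 : s₁ ≠ s₀ := fun h => hs₀ (h ▸ hs₁')
      obtain ⟨q, hq⟩ := Submodule.mem_span_singleton.mp hy0
      have hne : (0 : ℕ) ≠ idx s₀ := by have := (hidx_mem s₀).1; omega
      rw [if_neg hne, ← hq, ← hs₁', ← hbR, map_smul, Module.Basis.coord_apply, Module.Basis.repr_self,
        Finsupp.single_apply, if_neg hne01, smul_zero]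
    · obtain ⟨s₁, hs₁⟩ := exists_jwIndex_eq 2 g hjpos (by omega)
      have hs₁' : idx s₁ = j := hs₁
      rw [← hs₁', ← hbR, Module.Basis.coord_apply, Module.Basis.repr_self, Finsupp.single_apply]
      by_cases h : s₁ = s₀
      · subst h; rw [if_pos rfl, if_pos rfl]
      · rw [if_neg h, if_neg (fun h' => h (hidx_inj h'))]
  -- `[x_j] = θ (u_j)` on the units of `𝒪_v`
  have hθ : ∀ j, j ≤ d → absGaloisAbProj (v.adicCompletion F) (x j) =
      (LocalWeilDatum.isReciprocitySystemE (F := v.adicCompletion F) (E := v.adicCompletion F)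
        (LocalWeilDatum.isClassFieldTheory_localWeilDatum (v.adicCompletion F))).theta (unitsToK v (uO j)) := by
    intro j hj; rw [huO j hj]; exact (hwild j hj).2
  -- ONE TWIST `x_b ↦ x_b x_a` ⟹ the transvection `y_b ↦ y_b + y_a` (Kondo's computation), for any two basis positions
  have htwist : ∀ (sa sb : Fin 2 ⊕ Fin g × Fin 2), idx sb ≠ 1 → JWTwist σ τ x d (idx sa) (idx sb) →
      ∃ φ : (ModelMLFGaloisData.galois (closureAt v).k (closureAt v).K).tmPair.Pi ≃ₜ*
          (ModelMLFGaloisData.galois (closureAt v).k (closureAt v).K).tmPair.Pi,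
        (closureAt v).LiftActsOnUnitLogAs (closureAt v).residueChar hpk φ fun t => t + y.coord sb t • y sa := by
    rintro sa sb hsb ⟨φ, -, -, hφfix, hφb⟩
    have ha_le : idx sa ≤ d := (hidx_mem _).2
    have hb_le : idx sb ≤ d := (hidx_mem _).2
    refine ⟨φ, ?_⟩
    have hLfix : ∀ j, j ≤ d → j ≠ idx sb → liftUnits v φ (uO j) = uO j := fun j hj hjb =>
      liftUnits_eq_of_theta v φ (hθ j hj)
        ((congrArg (absGaloisAbProj (v.adicCompletion F)) (hφfix j hj hjb)).trans (hθ j hj))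
    have hLb : liftUnits v φ (uO (idx sb)) = uO (idx sb) * uO (idx sa) :=
      liftUnits_eq_of_theta v φ (hθ _ hb_le)
        ((congrArg (absGaloisAbProj (v.adicCompletion F)) hφb).trans
          (by rw [map_mul, map_mul, map_mul, hθ _ hb_le, hθ _ ha_le]))
    let T : v.adicCompletion F →ₗ[ℚ_[(closureAt v).residueChar]] v.adicCompletion F :=
      LinearMap.id + (y.coord sb).smulRight (y sa)
    have hT : ∀ t, T t = t + y.coord sb t • y sa := fun t => rfl
    have hgenT : ∀ s' ∈ S, galoisLog v (Additive.ofMul (liftUnits v φ s')) = T (galoisLog v (Additive.ofMul s')) := by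
      rintro _ ⟨j, hj, rfl⟩
      rw [hT, hycoord, hy]
      change _ = _ + bR.coord sb (yR j) • _
      rw [hcoord _ j hj hsb]
      by_cases hjb : j = idx sb
      · rw [if_pos hjb, one_smul, hjb, hLb, ofMul_mul, map_add]
      · rw [if_neg hjb, zero_smul, add_zero, hLfix j hj hjb]
    exact fun xx xx' aa aa' t t' h1 h2 h3 h4 h5 h6 =>
      (liftActsOnUnitLogAs_of_generators v hpk S hS φ T hgenT xx xx' aa aa' t t' h1 h2 h3 h4 h5 h6).trans (hT t)
  -- the answer
  refine ⟨g, hcg, y, fun i => ?_, ?_⟩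
  · -- Kondo's plane `i + 1`: `(a, b) = (idx (inr (i,0)), idx (inr (i,1))) = (2(i+1)+1, 2(i+1)+2)`
    have hi := i.2
    have ha : idx (Sum.inr (i, 0)) = 2 * ((i : ℕ) + 1) + 1 := by
      simp only [idx, Sum.elim_inr, Fin.val_zero]; omega
    have hb : idx (Sum.inr (i, 1)) = 2 * ((i : ℕ) + 1) + 2 := by
      simp only [idx, Sum.elim_inr, Fin.val_one]; omega
    have hplane : JWTwistPair σ τ x d (idx (Sum.inr (i, 0))) (idx (Sum.inr (i, 1))) := by
      rw [ha, hb]; exact hplanes ((i : ℕ) + 1) (by omega) (by omega)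
    have ha_le : idx (Sum.inr (i, 0)) ≤ d := (hidx_mem _).2
    have hb_le : idx (Sum.inr (i, 1)) ≤ d := (hidx_mem _).2
    refine ⟨htwist _ _ (by omega) (jwTwist_of_jwTwistPair hplane), ?_⟩
    -- `φ'_i : x_a ↦ x_a x_b⁻¹`
    obtain ⟨-, ⟨φ', -, -, hφ'fix, hφ'a⟩⟩ := hplane
    refine ⟨φ', ?_⟩
    have hLfix : ∀ j, j ≤ d → j ≠ idx (Sum.inr (i, 0)) → liftUnits v φ' (uO j) = uO j := fun j hj hja =>
      liftUnits_eq_of_theta v φ' (hθ j hj)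
        ((congrArg (absGaloisAbProj (v.adicCompletion F)) (hφ'fix j hj hja)).trans (hθ j hj))
    have hLa : liftUnits v φ' (uO (idx (Sum.inr (i, 0)))) = uO (idx (Sum.inr (i, 0))) * (uO (idx (Sum.inr (i, 1))))⁻¹ :=
      liftUnits_eq_of_theta v φ' (hθ _ ha_le)
        ((congrArg (absGaloisAbProj (v.adicCompletion F)) hφ'a).trans
          (by rw [map_mul, map_inv, map_mul, map_inv, map_mul, map_inv, hθ _ ha_le, hθ _ hb_le]))
    let T : v.adicCompletion F →ₗ[ℚ_[(closureAt v).residueChar]] v.adicCompletion F :=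
      LinearMap.id - (y.coord (Sum.inr (i, 0))).smulRight (y (Sum.inr (i, 1)))
    have hT : ∀ t, T t = t - y.coord (Sum.inr (i, 0)) t • y (Sum.inr (i, 1)) := fun t => rfl
    have hgenT : ∀ s' ∈ S, galoisLog v (Additive.ofMul (liftUnits v φ' s')) = T (galoisLog v (Additive.ofMul s')) := by
      rintro _ ⟨j, hj, rfl⟩
      rw [hT, hycoord, hy]
      change _ = _ - bR.coord (Sum.inr (i, 0)) (yR j) • _
      rw [hcoord _ j hj (by omega)]
      by_cases hja : j = idx (Sum.inr (i, 0))
      · rw [if_pos hja, one_smul, hja, hLa, ofMul_mul, ofMul_inv, map_add, map_neg, sub_eq_add_neg]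
      · rw [if_neg hja, zero_smul, sub_zero, hLfix j hj hja]
    exact fun xx xx' aa aa' t t' h1 h2 h3 h4 h5 h6 =>
      (liftActsOnUnitLogAs_of_generators v hpk S hS φ' T hgenT xx xx' aa aa' t t' h1 h2 h3 h4 h5 h6).trans (hT t)
  · -- the FIRST pair `(x_1, x_2) = (idx (inl 0), idx (inl 1))`
    have h1 : idx (Sum.inl 0) = 1 := by simp only [idx, Sum.elim_inl, Fin.val_zero]
    have h2 : idx (Sum.inl 1) = 2 := by simp only [idx, Sum.elim_inl, Fin.val_one]
    have hfirst' : JWTwist σ τ x d (idx (Sum.inl 0)) (idx (Sum.inl 1)) := by rw [h1, h2]; exact hfirst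
    exact htwist _ _ (by omega) hfirst'

end Summit.ABC.IUTFork.Thm311.Real

end
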